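import Summits.Ventures.Crystal3D.Theorems.StickyWulffConstantPolycrystalWulffBoundZoneChimera
import Summits.Ventures.Crystal3D.Theorems.StickyWulffConstantPolycrystalWulffBoundTwinCapReflect

/-!
# `PolycrystalWulffBound`: the SHARP TWIN SUPPORT GAP `h_{W(A)}(ν) ≤ h_{W(B)}(ν) + (1/√6)·h_{Dsc m}(ν)`

Route `StickyWulffConstant` of the venture `Summits/Ventures/Crystal3D`, crux `PolycrystalWulffBound`
(item `stmt-Ventures-19482`), second prover lane (poly-p2, gen 11).  For a frame `A` with the self-clause
of `Ax m`, a horizontal nearest-neighbour bond `u ∈ A '' Λ₀` that is also a mirror normal of the lattice,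
and the horizontal `⟨112⟩` unit vector `w ⊥ m, u`:

* `twin_slide_mem` — every point `y` of `W(A)` slides INTO the twin body along `w`:
  `y + t • w ∈ R_m '' W(A)` for some `|t| ≤ 2/√6` (cap reflections of `…TwinCapReflect` + the identity
  `R_m (y − 2⟪y,w⟫ w) = −R_u y`);
* `supportFn_le_twin_dir` — hence `h_{W(A)}(ν) ≤ h_{R_m W(A)}(ν) + (2/√6)·|⟪w, ν⟫|` for EVERY `ν`;
* `two_mul_min_abs_three_dir_le` — for the three `⟨112⟩` directions `w, w₂, w₃` (at 120°),
  `2·min_k |⟪w_k, ν⟫| ≤ √(⟪w,ν⟫² + ⟪u,ν⟫²)`;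
* `norm_horizontal_le_supportFn_cruxDisc` — `√(⟪w,ν⟫² + ⟪u,ν⟫²) ≤ h_{Dsc m}(ν)`;
* `supportFn_le_twin_disc` — with three admissible pairs `(u_k, w_k)`:
  `h_{W(A)}(ν) ≤ h_{R_m W(A)}(ν) + (1/√6)·h_{Dsc m}(ν)` for every `ν`.

`1/√6 = 0.408…` is SHARP (equality at `ν ∥ (1,1,−5)`, gap `0.3849 = (1/√6)·sin 109.47°`): the thin-plate /
BV-ellipticity threshold of the twin wall law (R18 `c₁_crit`), below the law `½`; input of the sharp twin body
change and of the hybrid single-axis rung.  WHAT THIS IS NOT: anything about textures; the crux is not claimed.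
-/

noncomputable section

open scoped BigOperators InnerProductSpace
open Set

namespace Summit.Ventures.Crystal3D.Theorems

open Summit.Ventures.Crystal3D.Cruxes.TextureLiminf.TexShadow (supportFn E3)
open Literature.MathematicalPhysics.StatisticalMechanics (fccStacking barlowStacking IsHaggSeq)

/-! ### The reflection identity `R_m (y − 2⟪y,w⟫ w) = −R_u y` for an orthonormal triple `(u, w, m)` -/

/-- Expansion of a vector in the orthonormal triple `(u, w, m)` of `E3`. -/
theorem eq_sum_orthonormal_triple {u w m : E3} (hu : ‖u‖ = 1) (hw : ‖w‖ = 1) (hm : ‖m‖ = 1)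
    (hum : ⟪u, m⟫_ℝ = 0) (hwm : ⟪w, m⟫_ℝ = 0) (hwu : ⟪w, u⟫_ℝ = 0) (y : E3) :
    y = ⟪u, y⟫_ℝ • u + ⟪w, y⟫_ℝ • w + ⟪m, y⟫_ℝ • m := by
  set v : Fin 3 → E3 := ![u, w, m] with hv
  have hmu : ⟪m, u⟫_ℝ = 0 := by rw [real_inner_comm]; exact hum
  have hmw : ⟪m, w⟫_ℝ = 0 := by rw [real_inner_comm]; exact hwm
  have huw : ⟪u, w⟫_ℝ = 0 := by rw [real_inner_comm]; exact hwu
  have hvon : Orthonormal ℝ v := by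
    rw [orthonormal_iff_ite]
    intro i j
    fin_cases i <;> fin_cases j <;> simp [hv, hu, hw, hm, hum, hwm, hwu, hmu, hmw, huw]
  have hvsp : ⊤ ≤ Submodule.span ℝ (Set.range v) :=
    (hvon.linearIndependent.span_eq_top_of_card_eq_finrank' (by simp)).ge
  set b : OrthonormalBasis (Fin 3) ℝ E3 := OrthonormalBasis.mk hvon hvsp with hb
  have hbv : ∀ i, b i = v i := fun i => by rw [hb, OrthonormalBasis.coe_mk]
  have hsum := b.sum_repr' y
  rw [Fin.sum_univ_three, hbv, hbv, hbv] at hsum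
  simpa [hv] using hsum.symm

/-- `R_m (y − (2⟪y,w⟫) • w) = −(R_u y)` for the reflections `R_m = (ℝ∙m)ᗮ.reflection`,
`R_u = (ℝ∙u)ᗮ.reflection` of an orthonormal triple `(u, w, m)`. -/
theorem reflection_m_sub_two_inner_eq_neg_reflection_u {u w m : E3} (hu : ‖u‖ = 1) (hw : ‖w‖ = 1)
    (hm : ‖m‖ = 1) (hum : ⟪u, m⟫_ℝ = 0) (hwm : ⟪w, m⟫_ℝ = 0) (hwu : ⟪w, u⟫_ℝ = 0) (y : E3) :
    (ℝ ∙ m)ᗮ.reflection (y - (2 * ⟪y, w⟫_ℝ) • w) = -((ℝ ∙ u)ᗮ.reflection y) := by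
  rw [reflection_orthogonal_unit_apply hm, reflection_orthogonal_unit_apply hu]
  have hmw : ⟪m, w⟫_ℝ = 0 := by rw [real_inner_comm]; exact hwm
  have hexp := eq_sum_orthonormal_triple hu hw hm hum hwm hwu y
  rw [inner_sub_right, real_inner_smul_right, hmw, mul_zero, sub_zero, real_inner_comm w y]
  -- `y − 2⟪w,y⟫ w − 2⟪m,y⟫ m = −(y − 2⟪u,y⟫ u)` from the expansion of `y`
  have e : y - (2 * ⟪w, y⟫_ℝ) • w - (2 * ⟪m, y⟫_ℝ) • m + (y - (2 * ⟪u, y⟫_ℝ) • u) = 0 := by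
    have h2 : (2 : ℝ) • y = (2 * ⟪u, y⟫_ℝ) • u + (2 * ⟪w, y⟫_ℝ) • w + (2 * ⟪m, y⟫_ℝ) • m := by
      conv_lhs => rw [hexp]
      simp only [smul_add, smul_smul]
    have : y - (2 * ⟪w, y⟫_ℝ) • w - (2 * ⟪m, y⟫_ℝ) • m + (y - (2 * ⟪u, y⟫_ℝ) • u) =
        (2 : ℝ) • y - ((2 * ⟪u, y⟫_ℝ) • u + (2 * ⟪w, y⟫_ℝ) • w + (2 * ⟪m, y⟫_ℝ) • m) := by
      rw [two_smul]; abel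
    rw [this, h2, sub_self]
  exact eq_neg_of_add_eq_zero_left e

/-! ### Every point of `W(A)` slides into the twin body along `w` by at most `2/√6` -/

/-- **Twin slide, pointwise.**  For a frame `A` with the self-clause of `Ax m`, a horizontal bond
`u ∈ A '' Λ₀` (`‖u‖ = 1`, `u ⊥ m`) whose mirror preserves the lattice, and a unit `w ⊥ m, u`: every
`y ∈ W(A)` has `y + t • w ∈ R_m '' W(A)` for some `|t| ≤ 2/√6`. -/
theorem twin_slide_mem {m : E3} {A : E3 ≃ₗᵢ[ℝ] E3}
    (hAx : ∃ (L : E3 ≃ₗᵢ[ℝ] E3) (s₁ s₂ : E3) (σ σ' : ℤ → ℤ), IsHaggSeq σ ∧ IsHaggSeq σ' ∧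
      L (EuclideanSpace.single (2 : Fin 3) (1 : ℝ)) = m ∧
      A '' fccStacking 1 (Real.sqrt (2 / 3)) ⊆
        (fun q => L q + s₁) '' barlowStacking 1 (Real.sqrt (2 / 3)) σ ∧
      A '' fccStacking 1 (Real.sqrt (2 / 3)) ⊆
        (fun q => L q + s₂) '' barlowStacking 1 (Real.sqrt (2 / 3)) σ')
    {u w : E3} (hu : u ∈ A '' fccStacking 1 (Real.sqrt (2 / 3))) (hu1 : ‖u‖ = 1) (hum : ⟪u, m⟫_ℝ = 0)
    (hw : ‖w‖ = 1) (hwm : ⟪w, m⟫_ℝ = 0) (hwu : ⟪w, u⟫_ℝ = 0)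
    (hmir : (ℝ ∙ u)ᗮ.reflection '' (A '' fccStacking 1 (Real.sqrt (2 / 3))) =
      A '' fccStacking 1 (Real.sqrt (2 / 3)))
    {y : E3} (hy : y ∈ {y : E3 | ∀ ν : E3, ⟪y, ν⟫_ℝ ≤ Real.sqrt 2 / 4 *
        ∑ᶠ w ∈ {w | w ∈ fccStacking 1 (Real.sqrt (2 / 3)) ∧ ‖w‖ = 1}, |⟪w, A.symm ν⟫_ℝ|}) :
    ∃ t : ℝ, |t| ≤ 2 / Real.sqrt 6 ∧ y + t • w ∈ (ℝ ∙ m)ᗮ.reflection ''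
      {y : E3 | ∀ ν : E3, ⟪y, ν⟫_ℝ ≤ Real.sqrt 2 / 4 *
        ∑ᶠ w ∈ {w | w ∈ fccStacking 1 (Real.sqrt (2 / 3)) ∧ ‖w‖ = 1}, |⟪w, A.symm ν⟫_ℝ|} := by
  set W : Set E3 := {y : E3 | ∀ ν : E3, ⟪y, ν⟫_ℝ ≤ Real.sqrt 2 / 4 *
    ∑ᶠ w ∈ {w | w ∈ fccStacking 1 (Real.sqrt (2 / 3)) ∧ ‖w‖ = 1}, |⟪w, A.symm ν⟫_ℝ|} with hW
  have hm : ‖m‖ = 1 := by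
    obtain ⟨L, -, -, -, -, -, -, hLm, -, -⟩ := hAx
    rw [← hLm, LinearIsometryEquiv.norm_map, PiLp.norm_single, norm_one]
  set Rm : E3 ≃ₗᵢ[ℝ] E3 := (ℝ ∙ m)ᗮ.reflection with hRm
  set Ru : E3 ≃ₗᵢ[ℝ] E3 := (ℝ ∙ u)ᗮ.reflection with hRu
  have hRuW : Ru '' W = W := cruxWulffBody_image_eq_of_latticeSymm hmir
  have hnegW : -W = W := neg_cruxWulffBody_eq A
  -- the slid point of any `z ∈ W(A)`: `z − 2⟪z,w⟫ w ∈ R_m '' W(A)`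
  have hslide : ∀ z ∈ W, z - (2 * ⟪z, w⟫_ℝ) • w ∈ Rm '' W := by
    intro z hz
    refine ⟨-(Ru z), ?_, ?_⟩
    · rw [← hnegW]
      refine Set.neg_mem_neg.2 ?_
      rw [← hRuW]
      exact ⟨z, hz, rfl⟩
    · have h := reflection_m_sub_two_inner_eq_neg_reflection_u hu1 hw hm hum hwm hwu z
      rw [← hRm, ← hRu] at h
      rw [← h, Submodule.reflection_reflection]
  have h6 : (0 : ℝ) < Real.sqrt 6 := Real.sqrt_pos.2 (by norm_num)
  have h26 : 0 ≤ 2 / Real.sqrt 6 := by positivity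
  by_cases hcase : |⟪y, w⟫_ℝ| ≤ 1 / Real.sqrt 6
  · -- small `w`-coordinate: the slide of `y` itself
    refine ⟨-(2 * ⟪y, w⟫_ℝ), ?_, ?_⟩
    · rw [abs_neg, abs_mul, abs_of_pos (by norm_num : (0:ℝ) < 2)]
      have : 2 * |⟪y, w⟫_ℝ| ≤ 2 * (1 / Real.sqrt 6) := by gcongr
      calc 2 * |⟪y, w⟫_ℝ| ≤ 2 * (1 / Real.sqrt 6) := this
        _ = 2 / Real.sqrt 6 := by ring
    · rw [neg_smul, ← sub_eq_add_neg]
      exact hslide y hy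
  · rw [not_le] at hcase
    rcases le_or_gt 0 ⟪y, w⟫_ℝ with hpos | hneg
    · -- upper cap: reflect first, then slide; total shift `−2/√6`
      have hs : 1 / Real.sqrt 6 ≤ ⟪y, w⟫_ℝ := by rw [abs_of_nonneg hpos] at hcase; exact hcase.le
      have hy₁ := cruxWulffBody_cap_reflect hAx hu hu1 hum hw hwm hwu hy hs
      set y₁ : E3 := y - (2 * (⟪y, w⟫_ℝ - 1 / Real.sqrt 6)) • w with hy₁def
      have hww : ⟪w, w⟫_ℝ = 1 := by rw [real_inner_self_eq_norm_sq, hw, one_pow]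
      have hy₁w : ⟪y₁, w⟫_ℝ = 2 / Real.sqrt 6 - ⟪y, w⟫_ℝ := by
        rw [hy₁def, inner_sub_left, real_inner_smul_left, hww]; ring
      refine ⟨-(2 / Real.sqrt 6), ?_, ?_⟩
      · rw [abs_neg, abs_of_nonneg h26]
      · have h := hslide y₁ hy₁
        have e : y₁ - (2 * ⟪y₁, w⟫_ℝ) • w = y + (-(2 / Real.sqrt 6)) • w := by
          rw [hy₁w, hy₁def, sub_sub, ← add_smul, neg_smul, ← sub_eq_add_neg]
          congr 1; congr 1; ring
        rw [← e]; exact h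
    · -- lower cap
      have hs : ⟪y, w⟫_ℝ ≤ -(1 / Real.sqrt 6) := by
        rw [abs_of_neg hneg] at hcase; linarith
      have hy₁ := cruxWulffBody_cap_reflect_neg hAx hu hu1 hum hw hwm hwu hy hs
      set y₁ : E3 := y - (2 * (⟪y, w⟫_ℝ + 1 / Real.sqrt 6)) • w with hy₁def
      have hww : ⟪w, w⟫_ℝ = 1 := by rw [real_inner_self_eq_norm_sq, hw, one_pow]
      have hy₁w : ⟪y₁, w⟫_ℝ = -(2 / Real.sqrt 6) - ⟪y, w⟫_ℝ := by
        rw [hy₁def, inner_sub_left, real_inner_smul_left, hww]; ring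
      refine ⟨2 / Real.sqrt 6, ?_, ?_⟩
      · rw [abs_of_nonneg h26]
      · have h := hslide y₁ hy₁
        have e : y₁ - (2 * ⟪y₁, w⟫_ℝ) • w = y + (2 / Real.sqrt 6) • w := by
          rw [hy₁w, hy₁def, sub_sub, ← add_smul]
          have : (2 * (⟪y, w⟫_ℝ + 1 / Real.sqrt 6) + 2 * (-(2 / Real.sqrt 6) - ⟪y, w⟫_ℝ)) =
              -(2 / Real.sqrt 6) := by ring
          rw [this, neg_smul, sub_neg_eq_add]
        rw [← e]; exact h

/-! ### The one-direction support gap -/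

/-- The crux's Wulff body is nonempty (it contains `0`). -/
theorem cruxWulffBody_nonempty (A : E3 ≃ₗᵢ[ℝ] E3) :
    ({y : E3 | ∀ ν : E3, ⟪y, ν⟫_ℝ ≤ Real.sqrt 2 / 4 *
        ∑ᶠ w ∈ {w | w ∈ fccStacking 1 (Real.sqrt (2 / 3)) ∧ ‖w‖ = 1}, |⟪w, A.symm ν⟫_ℝ|}).Nonempty :=
  ⟨0, zero_mem_cruxWulffBody A⟩

/-- **One-direction twin support gap.**  Under the hypotheses of `twin_slide_mem`:
`h_{W(A)}(ν) ≤ h_{R_m W(A)}(ν) + (2/√6)·|⟪w, ν⟫|` for every `ν`. -/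
theorem supportFn_le_twin_dir {m : E3} {A : E3 ≃ₗᵢ[ℝ] E3}
    (hAx : ∃ (L : E3 ≃ₗᵢ[ℝ] E3) (s₁ s₂ : E3) (σ σ' : ℤ → ℤ), IsHaggSeq σ ∧ IsHaggSeq σ' ∧
      L (EuclideanSpace.single (2 : Fin 3) (1 : ℝ)) = m ∧
      A '' fccStacking 1 (Real.sqrt (2 / 3)) ⊆
        (fun q => L q + s₁) '' barlowStacking 1 (Real.sqrt (2 / 3)) σ ∧
      A '' fccStacking 1 (Real.sqrt (2 / 3)) ⊆
        (fun q => L q + s₂) '' barlowStacking 1 (Real.sqrt (2 / 3)) σ')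
    {u w : E3} (hu : u ∈ A '' fccStacking 1 (Real.sqrt (2 / 3))) (hu1 : ‖u‖ = 1) (hum : ⟪u, m⟫_ℝ = 0)
    (hw : ‖w‖ = 1) (hwm : ⟪w, m⟫_ℝ = 0) (hwu : ⟪w, u⟫_ℝ = 0)
    (hmir : (ℝ ∙ u)ᗮ.reflection '' (A '' fccStacking 1 (Real.sqrt (2 / 3))) =
      A '' fccStacking 1 (Real.sqrt (2 / 3))) (ν : E3) :
    supportFn {y : E3 | ∀ ν : E3, ⟪y, ν⟫_ℝ ≤ Real.sqrt 2 / 4 *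
        ∑ᶠ w ∈ {w | w ∈ fccStacking 1 (Real.sqrt (2 / 3)) ∧ ‖w‖ = 1}, |⟪w, A.symm ν⟫_ℝ|} ν ≤
      supportFn ((ℝ ∙ m)ᗮ.reflection '' {y : E3 | ∀ ν : E3, ⟪y, ν⟫_ℝ ≤ Real.sqrt 2 / 4 *
        ∑ᶠ w ∈ {w | w ∈ fccStacking 1 (Real.sqrt (2 / 3)) ∧ ‖w‖ = 1}, |⟪w, A.symm ν⟫_ℝ|}) ν +
      2 / Real.sqrt 6 * |⟪w, ν⟫_ℝ| := by
  set W : Set E3 := {y : E3 | ∀ ν : E3, ⟪y, ν⟫_ℝ ≤ Real.sqrt 2 / 4 *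
    ∑ᶠ w ∈ {w | w ∈ fccStacking 1 (Real.sqrt (2 / 3)) ∧ ‖w‖ = 1}, |⟪w, A.symm ν⟫_ℝ|} with hW
  have hWc : IsCompact W := isCompact_cruxWulffBody A
  have hWne : W.Nonempty := cruxWulffBody_nonempty A
  have hRWc : IsCompact ((ℝ ∙ m)ᗮ.reflection '' W) := hWc.image (LinearIsometryEquiv.continuous _)
  have hbdd : BddAbove ((fun y : E3 => ⟪y, ν⟫_ℝ) '' ((ℝ ∙ m)ᗮ.reflection '' W)) :=
    (hRWc.image (continuous_id.inner continuous_const)).bddAbove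
  unfold supportFn
  refine csSup_le (hWne.image _) ?_
  rintro _ ⟨y, hy, rfl⟩
  obtain ⟨t, ht, hyt⟩ := twin_slide_mem hAx hu hu1 hum hw hwm hwu hmir hy
  have h1 : ⟪y + t • w, ν⟫_ℝ ≤ sSup ((fun y : E3 => ⟪y, ν⟫_ℝ) '' ((ℝ ∙ m)ᗮ.reflection '' W)) :=
    le_csSup hbdd ⟨y + t • w, hyt, rfl⟩
  have h2 : ⟪y, ν⟫_ℝ = ⟪y + t • w, ν⟫_ℝ - t * ⟪w, ν⟫_ℝ := by
    rw [inner_add_left, real_inner_smul_left]; ring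
  have h3 : -(t * ⟪w, ν⟫_ℝ) ≤ 2 / Real.sqrt 6 * |⟪w, ν⟫_ℝ| := by
    calc -(t * ⟪w, ν⟫_ℝ) ≤ |t * ⟪w, ν⟫_ℝ| := neg_le_abs _
      _ = |t| * |⟪w, ν⟫_ℝ| := abs_mul _ _
      _ ≤ 2 / Real.sqrt 6 * |⟪w, ν⟫_ℝ| := by gcongr
  linarith

/-! ### Three directions: `2·min_k |⟪w_k, ν⟫| ≤ √(⟪w,ν⟫² + ⟪u,ν⟫²) ≤ h_{Dsc m}(ν)` -/

/-- For reals `a, b` and the three numbers `a`, `(√3/2)b − a/2`, `−(√3/2)b − a/2` (the components of a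
planar vector along three unit vectors at `120°`), twice the least absolute value is at most
`√(a² + b²)`. -/
theorem two_mul_min_abs_three_dir_le (a b : ℝ) :
    2 * min |a| (min |Real.sqrt 3 / 2 * b - 1 / 2 * a| |-(Real.sqrt 3 / 2) * b - 1 / 2 * a|) ≤
      Real.sqrt (a ^ 2 + b ^ 2) := by
  have h3 : Real.sqrt 3 ^ 2 = 3 := Real.sq_sqrt (by norm_num)
  set r : ℝ := Real.sqrt (a ^ 2 + b ^ 2) with hr
  have hr0 : 0 ≤ r := Real.sqrt_nonneg _
  have hr2 : r ^ 2 = a ^ 2 + b ^ 2 := Real.sq_sqrt (by positivity)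
  by_contra hcon
  rw [not_le] at hcon
  have ha : r < 2 * |a| := by
    linarith [min_le_left |a| (min |Real.sqrt 3 / 2 * b - 1 / 2 * a| |-(Real.sqrt 3 / 2) * b - 1 / 2 * a|)]
  have hp : r < 2 * |Real.sqrt 3 / 2 * b - 1 / 2 * a| := by
    linarith [(min_le_right |a| _).trans (min_le_left |Real.sqrt 3 / 2 * b - 1 / 2 * a|
      |-(Real.sqrt 3 / 2) * b - 1 / 2 * a|)]
  have hq : r < 2 * |-(Real.sqrt 3 / 2) * b - 1 / 2 * a| := by
    linarith [(min_le_right |a| _).trans (min_le_right |Real.sqrt 3 / 2 * b - 1 / 2 * a|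
      |-(Real.sqrt 3 / 2) * b - 1 / 2 * a|)]
  -- square the three strict inequalities
  have ha2 : r ^ 2 < 4 * a ^ 2 := by nlinarith [abs_nonneg a, sq_abs a, ha, hr0]
  have hp2 : r ^ 2 < 4 * (Real.sqrt 3 / 2 * b - 1 / 2 * a) ^ 2 := by
    nlinarith [abs_nonneg (Real.sqrt 3 / 2 * b - 1 / 2 * a), sq_abs (Real.sqrt 3 / 2 * b - 1 / 2 * a), hp, hr0]
  have hq2 : r ^ 2 < 4 * (-(Real.sqrt 3 / 2) * b - 1 / 2 * a) ^ 2 := by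
    nlinarith [abs_nonneg (-(Real.sqrt 3 / 2) * b - 1 / 2 * a), sq_abs (-(Real.sqrt 3 / 2) * b - 1 / 2 * a),
      hq, hr0]
  rw [hr2] at ha2 hp2 hq2
  have e1 : b ^ 2 < 3 * a ^ 2 := by linarith
  have e2 : Real.sqrt 3 * (a * b) < b ^ 2 := by nlinarith [h3]
  have e3 : -(Real.sqrt 3 * (a * b)) < b ^ 2 := by nlinarith [h3]
  have hb2 : 0 < b ^ 2 := by linarith
  have hprod : 0 < (b ^ 2 - Real.sqrt 3 * (a * b)) * (b ^ 2 + Real.sqrt 3 * (a * b)) :=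
    mul_pos (by linarith) (by linarith)
  have hexp : (b ^ 2 - Real.sqrt 3 * (a * b)) * (b ^ 2 + Real.sqrt 3 * (a * b)) =
      b ^ 2 * (b ^ 2 - 3 * a ^ 2) := by
    have : Real.sqrt 3 * Real.sqrt 3 = 3 := by rw [← sq, h3]
    ring_nf
    nlinarith [this]
  rw [hexp] at hprod
  have : 0 < b ^ 2 - 3 * a ^ 2 := (mul_pos_iff_of_pos_left hb2).1 hprod
  linarith

/-- `√(⟪w,ν⟫² + ⟪u,ν⟫²) ≤ h_{Dsc m}(ν)` for an orthonormal pair `u, w ⊥ m` (test the disc with the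
normalised horizontal vector `(⟪u,ν⟫ u + ⟪w,ν⟫ w)/‖·‖`). -/
theorem sqrt_sq_add_sq_le_supportFn_cruxDisc {u w m : E3} (hu : ‖u‖ = 1) (hw : ‖w‖ = 1)
    (hum : ⟪u, m⟫_ℝ = 0) (hwm : ⟪w, m⟫_ℝ = 0) (hwu : ⟪w, u⟫_ℝ = 0) (ν : E3) :
    Real.sqrt (⟪w, ν⟫_ℝ ^ 2 + ⟪u, ν⟫_ℝ ^ 2) ≤ supportFn {y : E3 | ‖y‖ ≤ 1 ∧ ⟪y, m⟫_ℝ = 0} ν := by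
  have hbdd : BddAbove ((fun y : E3 => ⟪y, ν⟫_ℝ) '' {y : E3 | ‖y‖ ≤ 1 ∧ ⟪y, m⟫_ℝ = 0}) := by
    refine ⟨‖ν‖, ?_⟩
    rintro _ ⟨y, hy, rfl⟩
    calc ⟪y, ν⟫_ℝ ≤ ‖y‖ * ‖ν‖ := real_inner_le_norm y ν
      _ ≤ 1 * ‖ν‖ := mul_le_mul_of_nonneg_right hy.1 (norm_nonneg _)
      _ = ‖ν‖ := one_mul _
  set a : ℝ := ⟪w, ν⟫_ℝ with ha
  set b : ℝ := ⟪u, ν⟫_ℝ with hb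
  set r : ℝ := Real.sqrt (a ^ 2 + b ^ 2) with hr
  have hr0 : 0 ≤ r := Real.sqrt_nonneg _
  have hr2 : r ^ 2 = a ^ 2 + b ^ 2 := Real.sq_sqrt (by positivity)
  unfold supportFn
  rcases eq_or_lt_of_le hr0 with hrz | hrpos
  · -- `r = 0`: test with `0 ∈ Dsc`
    rw [← hrz]
    exact le_csSup hbdd ⟨0, ⟨by simp, by simp⟩, by simp⟩
  · set y₀ : E3 := r⁻¹ • (b • u + a • w) with hy₀
    have huu : ⟪u, u⟫_ℝ = 1 := by rw [real_inner_self_eq_norm_sq, hu, one_pow]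
    have hww : ⟪w, w⟫_ℝ = 1 := by rw [real_inner_self_eq_norm_sq, hw, one_pow]
    have huw : ⟪u, w⟫_ℝ = 0 := by rw [real_inner_comm]; exact hwu
    have hn2 : ‖b • u + a • w‖ ^ 2 = a ^ 2 + b ^ 2 := by
      rw [← real_inner_self_eq_norm_sq, inner_add_left, inner_add_right, inner_add_right,
        real_inner_smul_left, real_inner_smul_left, real_inner_smul_right, real_inner_smul_right,
        real_inner_smul_left, real_inner_smul_right, real_inner_smul_left, real_inner_smul_right,
        huu, hww, huw, hwu]
      ring
    have hn : ‖b • u + a • w‖ = r := by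
      rw [hr, ← hn2, Real.sqrt_sq (norm_nonneg _)]
    have hy₀n : ‖y₀‖ = 1 := by
      rw [hy₀, norm_smul, Real.norm_eq_abs, abs_of_pos (inv_pos.2 hrpos), hn, inv_mul_cancel₀ hrpos.ne']
    have hy₀m : ⟪y₀, m⟫_ℝ = 0 := by
      rw [hy₀, real_inner_smul_left, inner_add_left, real_inner_smul_left, real_inner_smul_left, hum, hwm]
      ring
    have hy₀ν : ⟪y₀, ν⟫_ℝ = r := by
      rw [hy₀, real_inner_smul_left, inner_add_left, real_inner_smul_left, real_inner_smul_left, ← hb, ← ha]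
      have : b * b + a * a = r * r := by rw [← sq, ← sq, ← sq, hr2]; ring
      rw [this, ← mul_assoc, inv_mul_cancel₀ hrpos.ne', one_mul]
    calc r = ⟪y₀, ν⟫_ℝ := hy₀ν.symm
      _ ≤ sSup ((fun y : E3 => ⟪y, ν⟫_ℝ) '' {y : E3 | ‖y‖ ≤ 1 ∧ ⟪y, m⟫_ℝ = 0}) :=
          le_csSup hbdd ⟨y₀, ⟨hy₀n.le, hy₀m⟩, rfl⟩

/-! ### The disc form of the gap (three admissible directions) -/

/-- **Sharp twin support gap (disc form).**  For a frame `A` with the self-clause of `Ax m` and THREE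
admissible pairs `(u, w)`, `(u₂, w₂)`, `(u₃, w₃)` (`w₂ = (√3/2)u − w/2`, `w₃ = −(√3/2)u − w/2`; each
`u_k` a horizontal bond of `A '' Λ₀` whose mirror preserves the lattice, `w_k ⊥ m, u_k`):
`h_{W(A)}(ν) ≤ h_{R_m W(A)}(ν) + (1/√6)·h_{Dsc m}(ν)` for every `ν`.  The constant `1/√6` is the
thin-plate threshold of the twin wall law (sharp at `ν ∥ (1,1,−5)`). -/
theorem supportFn_le_twin_disc {m : E3} {A : E3 ≃ₗᵢ[ℝ] E3}
    (hAx : ∃ (L : E3 ≃ₗᵢ[ℝ] E3) (s₁ s₂ : E3) (σ σ' : ℤ → ℤ), IsHaggSeq σ ∧ IsHaggSeq σ' ∧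
      L (EuclideanSpace.single (2 : Fin 3) (1 : ℝ)) = m ∧
      A '' fccStacking 1 (Real.sqrt (2 / 3)) ⊆
        (fun q => L q + s₁) '' barlowStacking 1 (Real.sqrt (2 / 3)) σ ∧
      A '' fccStacking 1 (Real.sqrt (2 / 3)) ⊆
        (fun q => L q + s₂) '' barlowStacking 1 (Real.sqrt (2 / 3)) σ')
    {u w : E3} (hu : u ∈ A '' fccStacking 1 (Real.sqrt (2 / 3))) (hu1 : ‖u‖ = 1) (hum : ⟪u, m⟫_ℝ = 0)
    (hw : ‖w‖ = 1) (hwm : ⟪w, m⟫_ℝ = 0) (hwu : ⟪w, u⟫_ℝ = 0)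
    (hmir : (ℝ ∙ u)ᗮ.reflection '' (A '' fccStacking 1 (Real.sqrt (2 / 3))) =
      A '' fccStacking 1 (Real.sqrt (2 / 3)))
    {u₂ w₂ u₃ w₃ : E3} (hw₂ : w₂ = (Real.sqrt 3 / 2) • u - (1 / 2 : ℝ) • w)
    (hw₃ : w₃ = -(Real.sqrt 3 / 2) • u - (1 / 2 : ℝ) • w)
    (hu₂ : u₂ ∈ A '' fccStacking 1 (Real.sqrt (2 / 3))) (hu₂1 : ‖u₂‖ = 1) (hu₂m : ⟪u₂, m⟫_ℝ = 0)
    (hwu₂ : ⟪w₂, u₂⟫_ℝ = 0)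
    (hmir₂ : (ℝ ∙ u₂)ᗮ.reflection '' (A '' fccStacking 1 (Real.sqrt (2 / 3))) =
      A '' fccStacking 1 (Real.sqrt (2 / 3)))
    (hu₃ : u₃ ∈ A '' fccStacking 1 (Real.sqrt (2 / 3))) (hu₃1 : ‖u₃‖ = 1) (hu₃m : ⟪u₃, m⟫_ℝ = 0)
    (hwu₃ : ⟪w₃, u₃⟫_ℝ = 0)
    (hmir₃ : (ℝ ∙ u₃)ᗮ.reflection '' (A '' fccStacking 1 (Real.sqrt (2 / 3))) =
      A '' fccStacking 1 (Real.sqrt (2 / 3)))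
    (ν : E3) :
    supportFn {y : E3 | ∀ ν : E3, ⟪y, ν⟫_ℝ ≤ Real.sqrt 2 / 4 *
        ∑ᶠ w ∈ {w | w ∈ fccStacking 1 (Real.sqrt (2 / 3)) ∧ ‖w‖ = 1}, |⟪w, A.symm ν⟫_ℝ|} ν ≤
      supportFn ((ℝ ∙ m)ᗮ.reflection '' {y : E3 | ∀ ν : E3, ⟪y, ν⟫_ℝ ≤ Real.sqrt 2 / 4 *
        ∑ᶠ w ∈ {w | w ∈ fccStacking 1 (Real.sqrt (2 / 3)) ∧ ‖w‖ = 1}, |⟪w, A.symm ν⟫_ℝ|}) ν +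
      1 / Real.sqrt 6 * supportFn {y : E3 | ‖y‖ ≤ 1 ∧ ⟪y, m⟫_ℝ = 0} ν := by
  have hm : ‖m‖ = 1 := by
    obtain ⟨L, -, -, -, -, -, -, hLm, -, -⟩ := hAx
    rw [← hLm, LinearIsometryEquiv.norm_map, PiLp.norm_single, norm_one]
  -- the two other directions are unit and horizontal
  have h3 : Real.sqrt 3 ^ 2 = 3 := Real.sq_sqrt (by norm_num)
  have huu : ⟪u, u⟫_ℝ = 1 := by rw [real_inner_self_eq_norm_sq, hu1, one_pow]
  have hww : ⟪w, w⟫_ℝ = 1 := by rw [real_inner_self_eq_norm_sq, hw, one_pow]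
  have huw : ⟪u, w⟫_ℝ = 0 := by rw [real_inner_comm]; exact hwu
  have hnormw : ∀ (ε : ℝ), ε = 1 ∨ ε = -1 → ‖(ε * (Real.sqrt 3 / 2)) • u - (1 / 2 : ℝ) • w‖ = 1 ∧
      ⟪(ε * (Real.sqrt 3 / 2)) • u - (1 / 2 : ℝ) • w, m⟫_ℝ = 0 := by
    intro ε hε
    have hε2 : ε ^ 2 = 1 := by rcases hε with h | h <;> rw [h] <;> norm_num
    constructor
    · have hsq : ‖(ε * (Real.sqrt 3 / 2)) • u - (1 / 2 : ℝ) • w‖ ^ 2 = 1 := by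
        rw [← real_inner_self_eq_norm_sq, inner_sub_left, inner_sub_right, inner_sub_right,
          real_inner_smul_left, real_inner_smul_left, real_inner_smul_right, real_inner_smul_right,
          real_inner_smul_left, real_inner_smul_right, real_inner_smul_left, real_inner_smul_right,
          huu, hww, huw, hwu]
        nlinarith [h3, hε2]
      nlinarith [norm_nonneg ((ε * (Real.sqrt 3 / 2)) • u - (1 / 2 : ℝ) • w), hsq]
    · rw [inner_sub_left, real_inner_smul_left, real_inner_smul_left, hum, hwm, mul_zero, mul_zero,
        sub_zero]
  have hw₂' : w₂ = (1 * (Real.sqrt 3 / 2)) • u - (1 / 2 : ℝ) • w := by rw [hw₂, one_mul]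
  have hw₃' : w₃ = (-1 * (Real.sqrt 3 / 2)) • u - (1 / 2 : ℝ) • w := by
    rw [hw₃, neg_one_mul, neg_smul]
  have hw₂n : ‖w₂‖ = 1 := by rw [hw₂']; exact (hnormw 1 (Or.inl rfl)).1
  have hw₂m : ⟪w₂, m⟫_ℝ = 0 := by rw [hw₂']; exact (hnormw 1 (Or.inl rfl)).2
  have hw₃n : ‖w₃‖ = 1 := by rw [hw₃']; exact (hnormw (-1) (Or.inr rfl)).1
  have hw₃m : ⟪w₃, m⟫_ℝ = 0 := by rw [hw₃']; exact (hnormw (-1) (Or.inr rfl)).2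
  -- the three one-direction gaps
  have g₁ := supportFn_le_twin_dir hAx hu hu1 hum hw hwm hwu hmir ν
  have g₂ := supportFn_le_twin_dir hAx hu₂ hu₂1 hu₂m hw₂n hw₂m hwu₂ hmir₂ ν
  have g₃ := supportFn_le_twin_dir hAx hu₃ hu₃1 hu₃m hw₃n hw₃m hwu₃ hmir₃ ν
  -- the components along `w₂, w₃` in terms of `a = ⟪w,ν⟫`, `b = ⟪u,ν⟫`
  have ha2 : ⟪w₂, ν⟫_ℝ = Real.sqrt 3 / 2 * ⟪u, ν⟫_ℝ - 1 / 2 * ⟪w, ν⟫_ℝ := by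
    rw [hw₂, inner_sub_left, real_inner_smul_left, real_inner_smul_left]
  have ha3 : ⟪w₃, ν⟫_ℝ = -(Real.sqrt 3 / 2) * ⟪u, ν⟫_ℝ - 1 / 2 * ⟪w, ν⟫_ℝ := by
    rw [hw₃]
    simp only [inner_sub_left, inner_neg_left, real_inner_smul_left, neg_smul]
    ring
  have hmin := two_mul_min_abs_three_dir_le ⟪w, ν⟫_ℝ ⟪u, ν⟫_ℝ
  rw [← ha2, ← ha3] at hmin
  have hdisc := sqrt_sq_add_sq_le_supportFn_cruxDisc hu1 hw hum hwm hwu (m := m) ν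
  have h6 : (0 : ℝ) < Real.sqrt 6 := Real.sqrt_pos.2 (by norm_num)
  have hkey : 2 / Real.sqrt 6 * min |⟪w, ν⟫_ℝ| (min |⟪w₂, ν⟫_ℝ| |⟪w₃, ν⟫_ℝ|) ≤
      1 / Real.sqrt 6 * supportFn {y : E3 | ‖y‖ ≤ 1 ∧ ⟪y, m⟫_ℝ = 0} ν := by
    rw [div_mul_eq_mul_div, div_le_iff₀ h6]
    have : 1 / Real.sqrt 6 * supportFn {y : E3 | ‖y‖ ≤ 1 ∧ ⟪y, m⟫_ℝ = 0} ν * Real.sqrt 6 =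
        supportFn {y : E3 | ‖y‖ ≤ 1 ∧ ⟪y, m⟫_ℝ = 0} ν := by
      field_simp
    rw [this]
    exact hmin.trans hdisc
  -- pick the direction realising the minimum
  rcases min_cases |⟪w, ν⟫_ℝ| (min |⟪w₂, ν⟫_ℝ| |⟪w₃, ν⟫_ℝ|) with ⟨h, -⟩ | ⟨h, -⟩
  · rw [h] at hkey; linarith
  · rcases min_cases |⟪w₂, ν⟫_ℝ| |⟪w₃, ν⟫_ℝ| with ⟨h', -⟩ | ⟨h', -⟩
    · rw [h, h'] at hkey; linarith
    · rw [h, h'] at hkey; linarith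

end Summit.Ventures.Crystal3D.Theorems

end
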